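import Summits.QuantumFields.GaugeBoot.Targets
import Mathlib.Analysis.SpecialFunctions.Log.Basic
import HarnessLib

/-!
# YM instrument cell — definitions: the Creutz ratio and the instrument target shapes (Q-A1)

Cell `ym-instrument` (HUMAN RULING D-0084 (2); director-ym R138; HOME `run/shared/lean/pub/ym-instrument/`), crew (a)
(certified positivity / loop-equation bootstrap), Lean typist seat `ym-instrument-boot-lean-1`. Definitions only.

HONEST FRAMING (page 1 of every file of this cell): the instrument cell produces CERTIFIED BOUNDS ON LATTICE
EXPECTATIONS at STATED gauge group, dimension, torus size and coupling `(G, D, L, β)` — here always `G = SU(N)` in the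
fundamental representation with the STANDARD Wilson action at `β_std` on the periodic lattice `(ℤ/L)^D`, in the
vocabulary of the inherited cell `pub-gaugeboot` (`Summit.QuantumFields.GaugeBoot.plaquetteExpectation`,
`wilsonLoopExpectation`, `PlaquetteWindow`, `WilsonLoopWindow`). NOTHING in this directory is a mass gap, a continuum
limit, a string tension or a large-`N` statement, and nothing is summit-bearing until typed as a hypothesis-free theorem.
This file certifies nothing: it fixes the vocabulary in which the pre-registered question Q-A1 of
`pub/ym-instrument/QUESTIONS.md` ("certified two-sided bounds on plaquette + 1×2, 2×2 loops at β ∈ {1.8, 2.0, 2.2, 2.4},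
SU(2), D = 4, tight enough to SIGN the Creutz ratio χ(2,2)") is typed.

## Content
* `creutzRatio N D L β R T` — the Creutz ratio `χ(R,T) = −log (W̄(R×T) W̄((R−1)×(T−1)) / (W̄((R−1)×T) W̄(R×(T−1))))`
  of the torus-averaged Wilson-loop expectations (M. Creutz, Phys. Rev. D 21 (1980) 2308, eq. (17); Montvay–Münster,
  *Quantum Fields on a Lattice* (1994) §3.5). Intended for `R, T ≥ 1` (natural-number subtraction: `χ(1,1) = −log W̄(1×1)`
  since `W̄(0×T) = W̄(R×0) = 1`; for `R = 0` or `T = 0` the value is the harmless junk `−log 1 = 0`).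
* `CreutzRatioPos N D L₀ β R T` — target shape "χ(R,T) > 0 on every even torus `L ≥ L₀`" (the SIGN asked by Q-A1);
  `CreutzRatioWindow N D L₀ β R T lo hi` — target shape "lo ≤ χ(R,T) ≤ hi on every even torus `L ≥ L₀`"
  (two-sided bracket derived from certified windows by exact arithmetic on the endpoints).
Even tori and an explicit threshold `L₀` are the convention of the inherited target shapes (A) (`PlaquetteWindow`), so that
every reflection-positivity block and every loop of a truncation is an instance of the tree theorems on `(ℤ/L)^D`.

What is NOT here: any number, any certificate, any claim that χ(2,2) has a sign at any β (that is Q-A1's open question),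
any `L → ∞` statement.
-/

noncomputable section

namespace Summit.QuantumFields.YangMills.Theorems.Instrument

open Summit.QuantumFields.GaugeBoot

/-- **The Creutz ratio** `χ(R,T) = −log ( W̄(R×T) · W̄((R−1)×(T−1)) / ( W̄((R−1)×T) · W̄(R×(T−1)) ) )` of the
torus-averaged rectangular Wilson-loop expectations of `SU(N)` lattice gauge theory on `(ℤ/L)^D` at standard Wilson
coupling `β_std = β` (`wilsonLoopExpectation N D L β R T`). Intended for `R, T ≥ 1` (ℕ-subtraction; `χ(1,1) = −log W̄(1×1)`).
M. Creutz, Phys. Rev. D 21 (1980) 2308, eq. (17): on the lattice `χ(R,T)` estimates the string tension in lattice units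
when large loops follow an area law — NO such interpretation is asserted anywhere in this cell. -/
def creutzRatio (N D L : ℕ) [NeZero L] (β : ℝ) (R T : ℕ) : ℝ :=
  -Real.log (wilsonLoopExpectation N D L β R T * wilsonLoopExpectation N D L β (R - 1) (T - 1) /
      (wilsonLoopExpectation N D L β (R - 1) T * wilsonLoopExpectation N D L β R (T - 1)))

/-- **Instrument target shape, sign of a Creutz ratio** (Q-A1): for `SU(N)` in `D` dimensions at standard coupling
`β_std = β`, on EVERY even torus `(ℤ/L)^D` with `L ≥ L₀`, `0 < χ(R,T)`. HONEST FRAMING: a statement about finitely many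
lattice expectations at the stated coupling on all large even tori; not a string tension, not a mass gap, no limit. -/
def CreutzRatioPos (N D L₀ : ℕ) (β : ℝ) (R T : ℕ) : Prop :=
  ∀ (L : ℕ) [NeZero L], Even L → L₀ ≤ L → 0 < creutzRatio N D L β R T

/-- **Instrument target shape, Creutz-ratio bracket**: on every even torus `(ℤ/L)^D` with `L ≥ L₀`,
`lo ≤ χ(R,T) ≤ hi` (DERIVED from certified Wilson-loop windows by exact arithmetic on their endpoints). -/
def CreutzRatioWindow (N D L₀ : ℕ) (β : ℝ) (R T : ℕ) (lo hi : ℝ) : Prop :=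
  ∀ (L : ℕ) [NeZero L], Even L → L₀ ≤ L → lo ≤ creutzRatio N D L β R T ∧ creutzRatio N D L β R T ≤ hi

/-- Unfolding lemma for `creutzRatio`. -/
theorem creutzRatio_def (N D L : ℕ) [NeZero L] (β : ℝ) (R T : ℕ) :
    creutzRatio N D L β R T =
      -Real.log (wilsonLoopExpectation N D L β R T * wilsonLoopExpectation N D L β (R - 1) (T - 1) /
        (wilsonLoopExpectation N D L β (R - 1) T * wilsonLoopExpectation N D L β R (T - 1))) := rfl

/-- A positive bracket signs the ratio: `CreutzRatioWindow … lo hi` with `0 < lo` gives `CreutzRatioPos`. -/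
theorem CreutzRatioWindow.pos {N D L₀ : ℕ} {β : ℝ} {R T : ℕ} {lo hi : ℝ}
    (h : CreutzRatioWindow N D L₀ β R T lo hi) (hlo : 0 < lo) : CreutzRatioPos N D L₀ β R T :=
  fun L _ hL hL₀ => hlo.trans_le (h L hL hL₀).1

/-- Monotonicity of the threshold: a sign valid from `L₀` is valid from any `L₁ ≥ L₀`. -/
theorem CreutzRatioPos.mono {N D L₀ L₁ : ℕ} {β : ℝ} {R T : ℕ} (h : CreutzRatioPos N D L₀ β R T)
    (hL : L₀ ≤ L₁) : CreutzRatioPos N D L₁ β R T :=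
  fun L _ hE hL₁ => h L hE (hL.trans hL₁)

end Summit.QuantumFields.YangMills.Theorems.Instrument

end
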